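import Mathlib
import Literature.MathematicalPhysics.QuantumFieldTheory.Balaban1983to89.B5FromB4

/-!
# `Balaban1983to89.B5Ineq137` — the displayed computation (1.135)–(1.137) of B5 Prop. 1.2, kernel-checked

B5 = T. Bałaban, *Propagators and renormalization transformations for lattice gauge theories. I*,
Commun. Math. Phys. **95**, 17–40 (1984) [Balaban1984PropagatorsI]; its reference [2] = B4 = T. Bałaban,
*Regularity and decay of lattice Green's functions*, Commun. Math. Phys. **89**, 571–597 (1983)
[Balaban1983RegularityDecay].  Journal page of B5 = PDF page + 16, of B4 = PDF page + 570.

CITATION HEADER (lean-in-tree rule 2026-08-18).  This module is a TYPED SKELETON of ONE printed passage, the last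
step of the proof of B5 Prop. 1.2 (pp. 39–40 [PDF 23–24]), verbatim: *"In paper [2] we have proved all the necessary
properties of G′, except the second order inequalities (1.112), (1.113). Let us prove for example (1.112). We use
Lemma 2.4 of that paper and the equality (2.34) with □ replaced by the whole torus. Let us write this equality
again, G′_k = C^{(0),η} + Σ_{j=1}^{k−1} a_j²(L^jη)^{−4}G′^η_jQ′*_jC^{(j),L^jη}Q′_jG′^η_j, (1.135) where we have written
explicitly indices and scales. We have"* [(1.136), quoted in full at `Display136`] *"and applying the estimates
(2.35)–(2.37) of Lemma 2.4 in [2] we obtain for x ∈ Δ̃(y), supp f ⊂ Δ̃(y′)"* [(1.137), quoted in full at `Ineq137`]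
*"i.e., the inequality (1.112) with δ₀ = ½δ′₀. The proof of (1.113) is similar. Thus we have finished the proof of
Proposition 1.2."*  The companion module `B5FromB4` (b05-g2) consumes this passage as the BARE hypothesis
`h137 : B4.Lemma24Printed fam₂₄ → SecondOrderFam famGp` of `B5FromB4.prop12G0_of_B4`; here that hypothesis is
DISCHARGED modulo located leaves (`h137_of_display136`), and re-inserted (`prop12G0_of_B4_via137`).
SIBLING SUB-NODE (cell LEMMAS row T02.2, carver ruling 2026-08-18T18:11:05Z): T02.2(b) = `B5Walk131` (b05-g2: the
walk sum (1.131) p. 38, step S1 of the same proof); the displays are disjoint — this file (T02.2(a)) types nothing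
of (1.118)–(1.131), and `B5Walk131` nothing of (1.132)–(1.137).

WHAT IS KERNEL-CHECKED HERE (the audit's "second engine": elementary real arithmetic over abstract FINITE carriers,
`ScaleData`; finite sums, no measure theory):
  (1.136) [`Display136`] + (2.35)/(2.37) on its kernels [`Leaf235to237`] + lattice geometry, row sums, norm facts
  ⟹ (1.137) at rate ½δ′₀ with O(1) = 2(c₀ + ā²c₀³R²)e^{(1/2)δ′₀c}Λ/(L^ε − 1)        (`kerW_bound`, `ineq137_of_display136`)
— every inequality sign of (1.137): the y, y′ convolution of the three kernels of the j-th term (rate δ′₀ split as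
¾δ′₀ kept + ¼δ′₀ spent on the two unit-lattice row sums, triangle inequality x̃ → y → y′ → x̃′: `conv_two_mid`);
the support bookkeeping behind "for x ∈ Δ̃(y), supp f ⊂ Δ̃(y′)" (a non-zero summand forces x′ ∈ Δ̃(y′) or
x ∈ Δ̃(y′), hence |y − y′| − c ≤ |x − x′| ≤ D̃ := |(L^jη)^{−1}(x − x′)| and e^{−(3/4)δ′₀D̃} ≤
e^{(1/2)δ′₀c}e^{−(1/2)δ′₀|y−y′|}e^{−(1/4)δ′₀D̃}: `exp_three_quarter_split`); the Hölder weight (|f(x′) − f(x)| ≤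
‖f‖_ε|x − x′|^ε for |x − x′| ≤ 1 by (1.109) and ≤ 2|f| otherwise, so ≤ (‖f‖_ε + 2|f|)|x − x′|^ε: `holder_split`;
|x − x′|^ε = (L^jη)^εD̃^ε: `scale_cancel`; D̃^ε ≤ 1 + D̃); the x′ Riemann sum; and the scale sum
Σ_{j=0}^{k−1}(L^jη)^ε ≤ 1/(L^ε − 1), η = L^{−k} ((1.18) p. 20) (`B5FromB4.scale_sum_bound`, the printed "O(1) → ∞ if
ε → 0" of (1.112));
  (1.137) ⟹ the entry (1.112) of Prop. 1.2 for G′                                       (`e4Entry_of_ineq137`, via `Dict137`);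
  [2] Lemma 2.4 (2.35)/(2.37) (`B4.Lemma24Printed`, BY NAME) ⟹ the leaf estimates          (`leaf_of_lemma24`, via `Dict24`);
  the family assembly, rates merged by min and constants by max{·, 0}                      (`secondOrderFam_of_entries`,
`h137_of_display136`), and its insertion into `B5FromB4.prop12G0_of_B4`                    (`prop12G0_of_B4_via137`).
WHAT REMAINS A NAMED HYPOTHESIS (= located leaves; cell GAPS C-pv07-6, G-pv07-2, and C-B5-11 (S3) which they refine):
* `Display136` — the identity (1.136) itself: (1.135) = [2] (2.34) on the torus with each term rescaled to its unit
  lattice (algebra of the model; typed undressed, see its docstring);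
* `Dict24` — reading the TORUS kernels of (1.136) in instances of [2]'s Lemma 2.4, which [2] prints for "rectangular
  parallelepiped □ ⊂ L^{−j}Z^d built of large blocks" only: "(2.34) with □ replaced by the whole torus" and the use
  of (2.35)–(2.37) there is B5's assertion, not a printed statement of [2] (G-pv07-2; the analogue of
  `B5FromB4.Dict.rect`, G-B5-15); it also carries the j = 0 kernel as ≤ 4 shifted values of C^{(0)} ([2] (2.39):
  "η^{1−α}4c₀O(1)‖f‖_∞", p. 582);
* `h113` — *"The proof of (1.113) is similar"* (from (1.135) and (2.36); nothing printed — C-pv07-6);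
* the model-evident hypothesis structures `Geometry`, `RowSums`, `NormFacts`, `Dict137`, `B5FromB4.ModelSigns` and
  the uniform bound |a_j| ≤ ā ([2] p. 573: "a_k is a constant proportional to a") — identities and evident lattice
  estimates of ℤ^d invisible to the abstract carriers; none of them is a cited fact, each is an explicit hypothesis.
TYPING REMARKS (cell DIVERGENCE D-pv07.8).  (i) Carriers: x̃ = (L^jη)^{−1}x, x̃′ live on the fine torus and y, y′ on
the unit lattice T₁^{(j)} — two types (`X`, `U`), so the homogeneous chain lemmas of `B6RandomWalk` / `B9Ineq349`
(one `Fintype S`) do not apply; the two-middle-point convolution is proved here (`conv_two_mid`).  (ii) (1.136) is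
typed without its ε-dressing (L^jη)^ε|x̃ − x̃′|^ε/|x′ − x|^ε ≡ 1 (x′ ≠ x), which the print inserts only to prepare
(1.137); it reappears inside the proof.  (iii) Rates as printed: δ′₀ on the kernels, ¼δ′₀ under the x′ sum, ½δ′₀
on |y − y′|; the remaining ¼δ′₀ is what the y, y′ sums consume (our reading of the first "O(1)" of (1.137)).
(iv) a_j² ≤ ā².  (v) The j = 0 term carries weight L^{−0·d} = 1 and the kernel `K0` on η^{−1}T_η, decaying in
η^{−1}|x − x′| = L^k|x − x′|.  (vi) 0 < ε < 1 as in (1.112); the Hölder quotient of (1.109) is a sup over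
|x − x′| ≤ 1 only, whence the "+ 2|f|".

Value = typed skeleton + kernel-checked arithmetic of one displayed computation + located leaves, NOT summit
progress.  Cell pub-balaban, unit `b2b-balaban-pv07-g3` (surge node prover #07, gen 3; LEMMAS row T02.2 SHARPEN);
census ids C-B5-11, C-pv07-6, G-pv07-2, D-pv07.8; companion module `B5FromB4.lean` (b05-g2).
-/

namespace Literature.MathematicalPhysics.QuantumFieldTheory.Balaban1983to89.B5Ineq137

open Finset

/-! ## §1. Generic real arithmetic (all [folklore], kernel-checked) -/

/-- The Hölder/sup split behind "sup_{x′} |f(x′) − f(x)|/|x′ − x|^ε ≤ O(1)(‖f‖_ε + |f|)" in (1.137): the norm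
‖f‖_ε of (1.109) p. 35 only sees pairs with |x − x′| ≤ 1 (`hclose`); for |x − x′| > 1 one has |x − x′|^ε ≥ 1 and
|f(x′) − f(x)| ≤ 2|f|.  Hence |f(x′) − f(x)| ≤ (‖f‖_ε + 2|f|)|x − x′|^ε for every pair. [folklore] -/
theorem holder_split {D H M ε u v : ℝ} (hD : 0 ≤ D) (hH : 0 ≤ H) (hM : 0 ≤ M) (hε : 0 < ε)
    (hclose : D ≤ 1 → |u - v| ≤ H * D ^ ε) (hu : |u| ≤ M) (hv : |v| ≤ M) :
    |u - v| ≤ (H + 2 * M) * D ^ ε := by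
  have hDε : 0 ≤ D ^ ε := Real.rpow_nonneg hD ε
  rcases le_or_gt D 1 with h | h
  · calc |u - v| ≤ H * D ^ ε := hclose h
      _ ≤ (H + 2 * M) * D ^ ε := by nlinarith
  · have h1 : 1 ≤ D ^ ε := Real.one_le_rpow h.le hε.le
    calc |u - v| ≤ |u| + |v| := abs_sub u v
      _ ≤ 2 * M := by linarith
      _ ≤ 2 * M * D ^ ε := by nlinarith
      _ ≤ (H + 2 * M) * D ^ ε := by nlinarith

/-- The scale factors of (1.136)/(1.137): (L^jη)·(L^jη)^{−1} = 1 with η = L^{−k} (B5 (1.18) p. 20), i.e.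
`L^{j−k} · L^{k−j} = 1` (real power times natural power, j ≤ k). [folklore] -/
theorem scale_cancel {L : ℝ} (hL : 0 < L) {j k : ℕ} (hjk : j ≤ k) :
    L ^ ((j : ℝ) - k) * L ^ (k - j) = 1 := by
  rw [← Real.rpow_natCast L (k - j), ← Real.rpow_add hL, Nat.cast_sub hjk]
  have : (j : ℝ) - k + ((k : ℝ) - j) = 0 := by ring
  rw [this, Real.rpow_zero]

/-- `1 ≤ L^{k−j}` for `L ≥ 1`: the rescaled distance |(L^jη)^{−1}(x − x′)| = L^{k−j}|x − x′| dominates |x − x′|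
for j ≤ k − 1. [folklore] -/
theorem dist_le_rescaled {L D : ℝ} (hL : 1 ≤ L) (hD : 0 ≤ D) (n : ℕ) : D ≤ L ^ n * D :=
  le_mul_of_one_le_left hD (one_le_pow₀ hL)

/-- The support bookkeeping of (1.137) in exponential form: if `t − c ≤ D̃` (|y − y′| − c(d) ≤ the rescaled distance,
which holds whenever the summand of (1.136) is non-zero) then, for δ ≥ 0,
`e^{−(3/4)δD̃} ≤ e^{(1/2)δc} · e^{−(1/2)δt} · e^{−(1/4)δD̃}` — the printed factorisation
"O(1)e^{−(1/2)δ′₀|y−y′|} · e^{−(1/4)δ′₀(L^jη)^{−1}|x−x′|}". [folklore] -/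
theorem exp_three_quarter_split {δ t c D : ℝ} (hδ : 0 ≤ δ) (h : t - c ≤ D) :
    Real.exp (-(3 / 4 * δ * D)) ≤
      Real.exp (δ / 2 * c) * Real.exp (-(δ / 2 * t)) * Real.exp (-(δ / 4 * D)) := by
  rw [← Real.exp_add, ← Real.exp_add]
  apply Real.exp_le_exp.mpr
  nlinarith [mul_le_mul_of_nonneg_left h hδ]

/-- **The y, y′ summation of (1.136) → (1.137)** ("applying the estimates (2.35)–(2.37)"): three exponentially
decaying kernels x̃ → y₁ → y₂ → x̃′ at rate δ over a finite unit-lattice set A, with the triangle inequality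
D ≤ d(x̃,y₁) + d(y₁,y₂) + d(y₂,x̃′) and the row sums Σ_{y∈A} e^{−κd(·,y)} ≤ R₁, R₂ at a rate κ with θ + κ ≤ δ,
convolve to `R₁R₂e^{−θD}` (here θ = ¾δ′₀, κ = ¼δ′₀).  The heterogeneous-type analogue of [4] (2.63), n = 3
(`B6RandomWalk.chain_split` is the homogeneous one). [folklore] -/
theorem conv_two_mid {X U : Type} (A : Finset U) (dL : X → U → ℝ) (dM : U → U → ℝ) (D : ℝ) (x x' : X)
    (δ θ κ R₁ R₂ : ℝ) (hθ : 0 ≤ θ) (hκ : 0 ≤ κ) (hsum : θ + κ ≤ δ) (hR₂ : 0 ≤ R₂)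
    (hdL : ∀ y, 0 ≤ dL x y) (hdL' : ∀ y, 0 ≤ dL x' y) (hdM : ∀ y y', 0 ≤ dM y y')
    (htri : ∀ y₁ y₂, D ≤ dL x y₁ + dM y₁ y₂ + dL x' y₂)
    (hR₁ : ∑ y ∈ A, Real.exp (-(κ * dL x y)) ≤ R₁)
    (hrow : ∀ y, ∑ y' ∈ A, Real.exp (-(κ * dM y y')) ≤ R₂) :
    ∑ y₁ ∈ A, ∑ y₂ ∈ A,
        Real.exp (-(δ * dL x y₁)) * Real.exp (-(δ * dM y₁ y₂)) * Real.exp (-(δ * dL x' y₂)) ≤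
      R₁ * R₂ * Real.exp (-(θ * D)) := by
  -- termwise: split the rate δ ≥ θ + κ, route θ along the chain to D, keep κ on the first two factors
  have key : ∀ y₁ y₂, Real.exp (-(δ * dL x y₁)) * Real.exp (-(δ * dM y₁ y₂)) * Real.exp (-(δ * dL x' y₂)) ≤
      Real.exp (-(θ * D)) * (Real.exp (-(κ * dL x y₁)) * Real.exp (-(κ * dM y₁ y₂))) := by
    intro y₁ y₂
    rw [← Real.exp_add, ← Real.exp_add, ← Real.exp_add, ← Real.exp_add]
    apply Real.exp_le_exp.mpr
    have h1 := mul_le_mul_of_nonneg_left (htri y₁ y₂) hθ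
    have h2 := mul_nonneg hκ (hdL' y₂)
    have h3 := mul_le_mul_of_nonneg_right hsum
      (add_nonneg (add_nonneg (hdL y₁) (hdM y₁ y₂)) (hdL' y₂))
    nlinarith
  have hR₁0 : 0 ≤ R₁ := le_trans (Finset.sum_nonneg fun y _ => Real.exp_nonneg _) hR₁
  calc ∑ y₁ ∈ A, ∑ y₂ ∈ A,
        Real.exp (-(δ * dL x y₁)) * Real.exp (-(δ * dM y₁ y₂)) * Real.exp (-(δ * dL x' y₂))
      ≤ ∑ y₁ ∈ A, ∑ y₂ ∈ A,
          Real.exp (-(θ * D)) * (Real.exp (-(κ * dL x y₁)) * Real.exp (-(κ * dM y₁ y₂))) :=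
        Finset.sum_le_sum fun y₁ _ => Finset.sum_le_sum fun y₂ _ => key y₁ y₂
    _ = Real.exp (-(θ * D)) * ∑ y₁ ∈ A, (Real.exp (-(κ * dL x y₁)) *
          ∑ y₂ ∈ A, Real.exp (-(κ * dM y₁ y₂))) := by
        rw [Finset.mul_sum]
        refine Finset.sum_congr rfl fun y₁ _ => ?_
        rw [Finset.mul_sum, Finset.mul_sum]
    _ ≤ Real.exp (-(θ * D)) * ∑ y₁ ∈ A, Real.exp (-(κ * dL x y₁)) * R₂ := by
        refine mul_le_mul_of_nonneg_left ?_ (Real.exp_nonneg _)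
        exact Finset.sum_le_sum fun y₁ _ => mul_le_mul_of_nonneg_left (hrow y₁) (Real.exp_nonneg _)
    _ = Real.exp (-(θ * D)) * ((∑ y₁ ∈ A, Real.exp (-(κ * dL x y₁))) * R₂) := by rw [Finset.sum_mul]
    _ ≤ Real.exp (-(θ * D)) * (R₁ * R₂) :=
        mul_le_mul_of_nonneg_left (mul_le_mul_of_nonneg_right hR₁ hR₂) (Real.exp_nonneg _)
    _ = R₁ * R₂ * Real.exp (-(θ * D)) := by ring


/-! ## §2. The carrier of (1.135)–(1.137) for ONE instance (k, T_η) and the printed displays -/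

variable {S : B5.Setting}

/-- Abstract carrier for the displayed computation (1.135)–(1.137) (pp. 39–40 [PDF 23–24]) of ONE instance
(k, T_η), η = L^{−k} ((1.18) p. 20), refining a `B5.Setting` S (whose `Site` = the points y ∈ T₁^{(k)} labelling the
cubes Δ̃(y), `dist y y′` = |y − y′|, and whose functional `e4 J y` = sup_{x∈Δ̃(y)}|(∇G′∇*J)(x)| is the left-hand
side of (1.112) for G′ = G′_k).  Fields: `X`, `TX` = the sites x ∈ T_η (a finite torus); `U`, `TU j` = the points
y ∈ T₁^{(j)} of the j-th unit lattice of (1.135), 1 ≤ j ≤ k − 1; `Dir` = the d lattice directions μ, ν;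
`F` = scalar functions f on T_η with `eval f x` = f(x), `holderF ε f` = ‖f‖_ε and `supF f` = |f| of
(1.108)–(1.109) p. 35, `comp J ν` = the component J_ν of a vector function J (`S.Loc`);
`E μ ν f x` = (∂_μG′_k∂*_νf)(x), the left-hand side of (1.136); `cube x y` = "x ∈ Δ̃(y)"; `distX x x′` = |x − x′|
on T_η; `dXU j x y` = |(L^jη)^{−1}x − y| and `dUU j y y′` = |y − y′| in the j-th rescaled torus; the KERNELS of
(1.136): `K0 μ ν x x′` = the kernel written C^{(0)}(η^{−1}x, η^{−1}x′) in (1.136) (that of the term ∂_μC^{(0),η}∂*_ν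
of ∂_μG′_k∂*_ν rescaled to the unit lattice η^{−1}T_η), `K1 j μ x y` = (∂^{L^{−j}}_μG′_jQ′*_j)((L^jη)^{−1}x, y),
`K2 j y y′` = C^{(j)}(y, y′), `K3 j ν y′ x′` = (Q′_jG′_j∂^{L^{−j}*}_ν)(y′, (L^jη)^{−1}x′); `a j` = a_j of (1.135).
[cite: Balaban1984PropagatorsI, (1.135)–(1.136) pp.39–40] -/
structure ScaleData (S : B5.Setting) where
  X : Type
  TX : Finset X
  U : Type
  TU : ℕ → Finset U
  Dir : Type
  F : Type
  eval : F → X → ℝ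
  holderF : ℝ → F → ℝ
  supF : F → ℝ
  comp : S.Loc → Dir → F
  E : Dir → Dir → F → X → ℝ
  cube : X → S.Site → Prop
  distX : X → X → ℝ
  dXU : ℕ → X → U → ℝ
  dUU : ℕ → U → U → ℝ
  K0 : Dir → Dir → X → X → ℝ
  K1 : ℕ → Dir → X → U → ℝ
  K2 : ℕ → U → U → ℝ
  K3 : ℕ → Dir → U → X → ℝ
  a : ℕ → ℝ

/-- "supp f ⊂ Δ̃(y′)" for a scalar function on T_η. [cite: Balaban1984PropagatorsI, (1.137) p.40] -/
def suppF (D : ScaleData S) (f : D.F) (y' : S.Site) : Prop :=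
  ∀ x : D.X, D.eval f x ≠ 0 → D.cube x y'

/-- The j-th kernel of (1.136) with its y, y′ summation: for j = 0 the kernel `K0` of the term C^{(0),η} of
(1.135); for 1 ≤ j ≤ k − 1, W_j(x, x′) = a_j² Σ_{y,y′∈T₁^{(j)}} (∂^{L^{−j}}_μG′_jQ′*_j)((L^jη)^{−1}x, y) C^{(j)}(y, y′)
(Q′_jG′_j∂^{L^{−j}*}_ν)(y′, (L^jη)^{−1}x′). [cite: Balaban1984PropagatorsI, (1.135)–(1.136) pp.39–40] -/
def kerW (D : ScaleData S) (j : ℕ) (μ ν : D.Dir) (x x' : D.X) : ℝ :=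
  if j = 0 then D.K0 μ ν x x'
  else D.a j ^ 2 * ∑ y₁ ∈ D.TU j, ∑ y₂ ∈ D.TU j, D.K1 j μ x y₁ * D.K2 j y₁ y₂ * D.K3 j ν y₂ x'

/-- **(1.136)** (pp. 39–40 [PDF 23–24]), verbatim: *"We have
(∂_μG′_k∂*_νf)(x) = Σ_{x′∈T_η} η^d(∂_μG′_k∂*_ν)(x, x′)(f(x′) − f(x))
= η^ε Σ_{x′} C^{(0)}(η^{−1}x, η^{−1}x′)|η^{−1}x − η^{−1}x′|^ε (f(x′) − f(x))/|x′ − x|^ε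
+ Σ_{j=1}^{k−1} (L^jη)^ε a_j² Σ_{y,y′∈T₁^{(j)}} (∂^{L^{−j}}_μG′_jQ′*_j)((L^jη)^{−1}x, y)C^{(j)}(y, y′)
· Σ_{x′} L^{−jd}(Q′_jG′_j∂^{L^{−j}*}_ν)(y′, (L^jη)^{−1}x′)|(L^jη)^{−1}x − (L^jη)^{−1}x′|^ε (f(x′) − f(x))/|x′ − x|^ε,
(1.136)"* — the kernel of (1.135) = [2] (2.34) "with □ replaced by the whole torus", each term rescaled to its unit
lattice.  TYPING: the display multiplies and divides the j-th term by |(L^jη)^{−1}(x − x′)|^ε; since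
(L^jη)^ε|(L^jη)^{−1}(x − x′)|^ε/|x′ − x|^ε = 1 for x′ ≠ x and the x′ = x term vanishes, (1.136) is the identity
below (j = 0 included as the C^{(0)} term, L^{−0·d} = 1, finite sums rearranged); the Hölder weight is
re-introduced in the proof of `ineq137_of_display136` (`holder_split`, `scale_cancel`). [cite: Balaban1984PropagatorsI, (1.135)–(1.136) pp.39–40] -/
def Display136 (D : ScaleData S) (L : ℝ) (d : ℕ) : Prop :=
  ∀ (μ ν : D.Dir) (f : D.F) (x : D.X), x ∈ D.TX →
    D.E μ ν f x = ∑ j ∈ Finset.range S.k, ∑ x' ∈ D.TX,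
      (L ^ (j * d))⁻¹ * kerW D j μ ν x x' * (D.eval f x' - D.eval f x)

/-- **The estimates (2.35), (2.37) of Lemma 2.4 in [2] as applied in (1.137)** ("We use Lemma 2.4 of that paper and
the equality (2.34) with □ replaced by the whole torus", p. 39).  [2] = [Balaban1983RegularityDecay], Lemma 2.4
p. 582 [PDF 12], verbatim: *"There exist positive constants c₀, δ₀, and for α < 1, there exists a constant c₁, such
that |(G_j(□)Q*_j)(x, y)|, |(∂^{L^{−j}}_μG_j(□)Q*_j)(x, y)| ≤ c₀e^{−δ₀|x−y|}, (2.35) … |C^{(j)}(□; y, y′)| ≤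
c₀e^{−δ₀|y−y′|}, (2.37) for arbitrary non-negative integer j, arbitrary, rectangular parallelepiped □ ⊂ L^{−j}Z^d
built of large blocks, and x, x′ ∈ □, y, y′ ∈ □^{(j)} = □ ∩ Z^d."*  As USED at rate δ′₀ with constant c₀ on the
kernels of `ScaleData`: the two G′Q′* kernels `K1`, `K3` by (2.35) (K3 is the transpose of a (2.35)-kernel, G′_j
symmetric), `K2` by (2.37), and the j = 0 kernel `K0` by (2.37) at j = 0 composed with the unit-lattice differences
∂_μ, ∂*_ν (constant enlarged, cf. [2] (2.39) "η^{1−α}4c₀O(1)").  Here □ = the whole torus, which is NOT a case of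
the printed lemma (a parallelepiped): B5 asserts the torus version in the quoted clause — a LOCATED LEAF (cell GAPS
G-pv07-2), discharged from `B4.Lemma24Printed` by name through the dictionary `Dict24` below (`leaf_of_lemma24`).
[cite: Balaban1983RegularityDecay, Lemma 2.4 (2.35)/(2.37) p.582; Balaban1984PropagatorsI, p.39] -/
def Leaf235to237 (D : ScaleData S) (L c₀ δ₀' : ℝ) : Prop :=
  (∀ (μ ν : D.Dir) (x x' : D.X),
      |D.K0 μ ν x x'| ≤ c₀ * Real.exp (-(δ₀' * (L ^ S.k * D.distX x x')))) ∧
  ∀ j : ℕ, 1 ≤ j → j < S.k →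
    (∀ (μ : D.Dir) (x : D.X) (y : D.U), |D.K1 j μ x y| ≤ c₀ * Real.exp (-(δ₀' * D.dXU j x y))) ∧
    (∀ (y y' : D.U), |D.K2 j y y'| ≤ c₀ * Real.exp (-(δ₀' * D.dUU j y y'))) ∧
    (∀ (ν : D.Dir) (y : D.U) (x' : D.X), |D.K3 j ν y x'| ≤ c₀ * Real.exp (-(δ₀' * D.dXU j x' y)))

/-- **(1.137)** (p. 40 [PDF 24]), verbatim: *"and applying the estimates (2.35)–(2.37) of Lemma 2.4 in [2] we obtain
for x ∈ Δ̃(y), supp f ⊂ Δ̃(y′)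
|∂_μG′_k∂*_νf)(x)| ≤ Σ_{j=0}^{k−1}(L^jη)^εO(1)e^{−(1/2)δ′₀|y−y′|}
· Σ_{x′} L^{−jd}e^{−(1/4)δ′₀(L^jη)^{−1}|x−x′|}|(L^jη)^{−1}(x − x′)|^ε sup_{x′} |f(x′) − f(x)|/|x′ − x|^ε
≤ O(1)e^{−(1/2)δ′₀|y−y′|}(‖f‖_ε + |f|), (1.137) i.e., the inequality (1.112) with δ₀ = ½δ′₀."*  Typed: the outer
inequality, for 0 < ε < 1 ((1.112): "O(1) depending on d and ε (O(1) → ∞ if ε → 0)"), with the ε-dependent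
constant `Cε ε` and the rate `δ` as parameters (`ineq137_of_display136` gives δ = ½δ′₀ and an explicit Cε).
[cite: Balaban1984PropagatorsI, (1.137) p.40] -/
def Ineq137 (D : ScaleData S) (Cε : ℝ → ℝ) (δ : ℝ) : Prop :=
  ∀ (ε : ℝ) (μ ν : D.Dir) (f : D.F) (x : D.X) (y y' : S.Site), 0 < ε → ε < 1 → x ∈ D.TX →
    D.cube x y → suppF D f y' →
    |D.E μ ν f x| ≤ Cε ε * Real.exp (-(δ * S.dist y y')) * (D.holderF ε f + D.supF f)

/-! ## §3. Model-evident facts of the lattice, as explicit hypotheses (none is a cited fact) -/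

/-- Geometry of the tori, invisible to the abstract carrier: distances are non-negative; the TRIANGLE INEQUALITY in
the j-th rescaled torus along x̃ → y → y′ → x̃′ for the rescaled distance |(L^jη)^{−1}(x − x′)| = L^{k−j}|x − x′|
(η = L^{−k}); and the cube facts of p. 35 ("Cubes Δ̃(y) are … cubes of size 2 and with a center at y"): x ∈ Δ̃(y),
x′ ∈ Δ̃(y′) ⇒ |x − x′| ≥ |y − y′| − c and x ∈ Δ̃(y) ∩ Δ̃(y′) ⇒ |y − y′| ≤ c, with c = c(d) (`cc`). [folklore] -/
structure Geometry (D : ScaleData S) (L cc : ℝ) : Prop where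
  distX_nonneg : ∀ x x' : D.X, 0 ≤ D.distX x x'
  dXU_nonneg : ∀ (j : ℕ) (x : D.X) (y : D.U), 0 ≤ D.dXU j x y
  dUU_nonneg : ∀ (j : ℕ) (y y' : D.U), 0 ≤ D.dUU j y y'
  tri : ∀ (j : ℕ) (x x' : D.X) (y₁ y₂ : D.U), 1 ≤ j → j < S.k →
    L ^ (S.k - j) * D.distX x x' ≤ D.dXU j x y₁ + D.dUU j y₁ y₂ + D.dXU j x' y₂
  cube_sep : ∀ (x x' : D.X) (y y' : S.Site), D.cube x y → D.cube x' y' → S.dist y y' - cc ≤ D.distX x x'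
  cube_near : ∀ (x : D.X) (y y' : S.Site), D.cube x y → D.cube x y' → S.dist y y' ≤ cc

/-- The lattice sums of (1.137) at rate κ (= ¼δ′₀), uniform in the scale and the torus: the unit-lattice row sums
Σ_{y∈T₁^{(j)}} e^{−κ|x̃−y|}, Σ_{y′∈T₁^{(j)}} e^{−κ|y−y′|} ≤ R (the shape of [4] (2.61)), and the Riemann sum of the
display, Σ_{x′∈T_η} L^{−jd}e^{−κ(L^jη)^{−1}|x−x′|}(1 + |(L^jη)^{−1}(x − x′)|) ≤ Λ ((L^jη)^{−1}x′ runs over an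
L^{−j}-lattice of cell volume L^{−jd}; |·|^ε ≤ 1 + |·| for 0 ≤ ε ≤ 1).  Evident for the lattice ℤ^d and every
κ > 0; invisible to the carrier. [folklore] -/
structure RowSums (D : ScaleData S) (L : ℝ) (d : ℕ) (κ R Λ : ℝ) : Prop where
  R_nonneg : 0 ≤ R
  Λ_nonneg : 0 ≤ Λ
  rowXU : ∀ (j : ℕ) (x : D.X), 1 ≤ j → j < S.k → ∑ y ∈ D.TU j, Real.exp (-(κ * D.dXU j x y)) ≤ R
  rowUU : ∀ (j : ℕ) (y : D.U), 1 ≤ j → j < S.k → ∑ y' ∈ D.TU j, Real.exp (-(κ * D.dUU j y y')) ≤ R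
  lat : ∀ (j : ℕ) (x : D.X), j < S.k → x ∈ D.TX →
    ∑ x' ∈ D.TX, (L ^ (j * d))⁻¹ * (Real.exp (-(κ * (L ^ (S.k - j) * D.distX x x'))) *
      (1 + L ^ (S.k - j) * D.distX x x')) ≤ Λ

/-- The norms (1.108)–(1.109) p. 35 read on scalar functions: *"|A| = max_μ sup_x |A_μ(x)|"*,
*"‖A‖_α = max_μ sup_{x,x′:|x−x′|≤1} |x − x′|^{−α}|A_μ(x) − A_μ(x′)|"* — the Hölder quotient is controlled for
|x − x′| ≤ 1 only, and both are sups of non-negative quantities. [cite: Balaban1984PropagatorsI, (1.108)–(1.109) p.35] -/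
structure NormFacts (D : ScaleData S) : Prop where
  holder_le : ∀ (ε : ℝ) (f : D.F) (x x' : D.X), 0 < ε → D.distX x x' ≤ 1 →
    |D.eval f x' - D.eval f x| ≤ D.holderF ε f * D.distX x x' ^ ε
  sup_le : ∀ (f : D.F) (x : D.X), |D.eval f x| ≤ D.supF f
  holder_nonneg : ∀ (ε : ℝ) (f : D.F), 0 ≤ D.holderF ε f
  sup_nonneg : ∀ f : D.F, 0 ≤ D.supF f

/-- The dictionary between the scalar display (1.136)–(1.137) and the entry (1.112) of `B5.Setting`: the components
J_ν of J have supp J_ν ⊂ supp J ⊂ Δ̃(y′), ‖J_ν‖_ε ≤ ‖J‖_ε, |J_ν| ≤ |J| ((1.108)–(1.109) are maxima over μ); and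
`e4 J y` = sup_{x∈Δ̃(y)} max_μ |Σ_{ν=1}^{d}(∂_μG′∂*_νJ_ν)(x)| is at most d times a common bound of the d² scalar
quantities |(∂_μG′∂*_νJ_ν)(x)|, x ∈ Δ̃(y) ∩ T_η.  Identities of the model, invisible to the carriers. [folklore] -/
structure Dict137 (D : ScaleData S) (d : ℕ) : Prop where
  supp : ∀ (J : S.Loc) (y' : S.Site) (ν : D.Dir), S.suppIn J y' → suppF D (D.comp J ν) y'
  holder_le : ∀ (ε : ℝ) (J : S.Loc) (ν : D.Dir), D.holderF ε (D.comp J ν) ≤ S.holder ε J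
  sup_le : ∀ (J : S.Loc) (ν : D.Dir), D.supF (D.comp J ν) ≤ S.supNorm J
  e4_le : ∀ (J : S.Loc) (y : S.Site) (b : ℝ), 0 ≤ b →
    (∀ (μ ν : D.Dir) (x : D.X), x ∈ D.TX → D.cube x y → |D.E μ ν (D.comp J ν) x| ≤ b) →
    S.e4 J y ≤ d * b

/-- The dictionary between the kernels of (1.136) on the TORUS and the instances of [2]'s Lemma 2.4
(`B4.ScaleSetting`, one instance = (j; a parallelepiped □ built of large blocks); its fields `kerDGQ`, `kerC` are the
absolute values |(∂^{L^{−j}}_μG_j(□)Q*_j)(x, y)|, |C^{(j)}(□; y, y′)|).  `mid`: for 1 ≤ j ≤ k − 1 the three kernels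
of the j-th term are read in an instance of the family with `rectLarge`, with the SAME distances (K3 = the transpose
(Q′_jG′_j∂^{L^{−j}*}_ν)(y′, x̃′) of a (2.35)-kernel, G′_j symmetric at A = 0).  `zero`: the j = 0 kernel (that of
∂_μC^{(0),η}∂*_ν on the unit lattice η^{−1}T_η) is a signed sum of at most 4 values C^{(0)}(u, u′) at pairs shifted
by at most one lattice step from (η^{−1}x, η^{−1}x′), |u − u′| ≥ η^{−1}|x − x′| − s₀ (cf. [2] (2.39): "4c₀").  THIS
IS WHERE "the equality (2.34) with □ replaced by the whole torus" (p. 39) IS LOAD-BEARING: [2] prints Lemma 2.4 for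
parallelepipeds □ ⊂ L^{−j}ℤ^d only; reading the torus kernels in an instance with `rectLarge` is B5's assertion,
not a printed theorem of [2] — located leaf, cell GAPS G-pv07-2 (the analogue of `B5FromB4.Dict.rect`, G-B5-15).
[cite: Balaban1984PropagatorsI, p.39; Balaban1983RegularityDecay, Lemma 2.4 p.582] -/
structure Dict24 {I₂₄ : Type} (fam₂₄ : I₂₄ → B4.ScaleSetting) (D : ScaleData S) (L s₀ : ℝ) : Prop where
  mid : ∀ j : ℕ, 1 ≤ j → j < S.k → ∃ i : I₂₄, (fam₂₄ i).rectLarge ∧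
    ∃ (σ : D.X → (fam₂₄ i).SiteF) (τ : D.U → (fam₂₄ i).SiteU) (dir : D.Dir → (fam₂₄ i).Dir),
      (∀ (μ : D.Dir) (x : D.X) (y : D.U), |D.K1 j μ x y| ≤ (fam₂₄ i).kerDGQ (dir μ) (σ x) (τ y)) ∧
      (∀ (ν : D.Dir) (y : D.U) (x' : D.X), |D.K3 j ν y x'| ≤ (fam₂₄ i).kerDGQ (dir ν) (σ x') (τ y)) ∧
      (∀ y y' : D.U, |D.K2 j y y'| ≤ (fam₂₄ i).kerC (τ y) (τ y')) ∧
      (∀ (x : D.X) (y : D.U), (fam₂₄ i).distF (σ x) (τ y) = D.dXU j x y) ∧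
      (∀ y y' : D.U, (fam₂₄ i).distU (τ y) (τ y') = D.dUU j y y')
  zero : ∃ i : I₂₄, (fam₂₄ i).rectLarge ∧
    ∃ P : D.Dir → D.Dir → D.X → D.X → Finset ((fam₂₄ i).SiteU × (fam₂₄ i).SiteU),
      (∀ (μ ν : D.Dir) (x x' : D.X), (P μ ν x x').card ≤ 4) ∧
      (∀ (μ ν : D.Dir) (x x' : D.X), |D.K0 μ ν x x'| ≤ ∑ p ∈ P μ ν x x', (fam₂₄ i).kerC p.1 p.2) ∧
      (∀ (μ ν : D.Dir) (x x' : D.X), ∀ p ∈ P μ ν x x',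
        L ^ S.k * D.distX x x' - s₀ ≤ (fam₂₄ i).distU p.1 p.2)

/-! ## §4. Kernel-checked: (1.136) + (2.35)/(2.37) ⟹ (1.137) ⟹ (1.112) for G′, δ₀ = ½δ′₀ -/

/-- **Per-scale kernel bound** (the y, y′ summation of (1.136)): with (2.35)/(2.37) at rate δ′₀, the row sums at
rate ¼δ′₀ and the triangle inequality, |W_j(x, x′)| ≤ (c₀ + ā²c₀³R²)e^{−(3/4)δ′₀|(L^jη)^{−1}(x−x′)|} for every
0 ≤ j ≤ k − 1 (|a_j| ≤ ā; j = 0: the single kernel, e^{−δ′₀D̃} ≤ e^{−(3/4)δ′₀D̃}). [cite: Balaban1984PropagatorsI, (1.136)–(1.137) p.40] -/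
theorem kerW_bound (D : ScaleData S) (L c₀ δ₀' cc ā R Λ : ℝ) (d : ℕ) (hL : 1 ≤ L) (hc₀ : 0 ≤ c₀)
    (hδ : 0 ≤ δ₀') (ha : ∀ j, |D.a j| ≤ ā) (hleaf : Leaf235to237 D L c₀ δ₀')
    (G : Geometry D L cc) (Rw : RowSums D L d (δ₀' / 4) R Λ) {j : ℕ} (hj : j < S.k) (μ ν : D.Dir)
    (x x' : D.X) :
    |kerW D j μ ν x x'| ≤
      (c₀ + ā ^ 2 * c₀ ^ 3 * R ^ 2) * Real.exp (-(3 / 4 * δ₀' * (L ^ (S.k - j) * D.distX x x'))) := by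
  have hL0 : 0 ≤ L := le_trans zero_le_one hL
  have hdX : 0 ≤ D.distX x x' := G.distX_nonneg x x'
  have hDt : 0 ≤ L ^ (S.k - j) * D.distX x x' := mul_nonneg (pow_nonneg hL0 _) hdX
  have hextra : 0 ≤ ā ^ 2 * c₀ ^ 3 * R ^ 2 := by positivity
  rcases Nat.eq_zero_or_pos j with hj0 | hjpos
  · subst hj0
    rw [kerW, if_pos rfl, Nat.sub_zero]
    calc |D.K0 μ ν x x'| ≤ c₀ * Real.exp (-(δ₀' * (L ^ S.k * D.distX x x'))) := hleaf.1 μ ν x x'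
      _ ≤ c₀ * Real.exp (-(3 / 4 * δ₀' * (L ^ S.k * D.distX x x'))) := by
          refine mul_le_mul_of_nonneg_left (Real.exp_le_exp.mpr ?_) hc₀
          have : 0 ≤ L ^ S.k * D.distX x x' := by simpa using hDt
          nlinarith
      _ ≤ (c₀ + ā ^ 2 * c₀ ^ 3 * R ^ 2) * Real.exp (-(3 / 4 * δ₀' * (L ^ S.k * D.distX x x'))) :=
          mul_le_mul_of_nonneg_right (le_add_of_nonneg_right hextra) (Real.exp_nonneg _)
  · have hj1 : 1 ≤ j := hjpos
    have hjne : j ≠ 0 := Nat.pos_iff_ne_zero.mp hjpos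
    rw [kerW, if_neg hjne]
    obtain ⟨h1, h2, h3⟩ := hleaf.2 j hj1 hj
    have haj : D.a j ^ 2 ≤ ā ^ 2 := by
      calc D.a j ^ 2 = |D.a j| ^ 2 := (sq_abs _).symm
        _ ≤ ā ^ 2 := pow_le_pow_left₀ (abs_nonneg _) (ha j) 2
    have conv := conv_two_mid (D.TU j) (D.dXU j) (D.dUU j) (L ^ (S.k - j) * D.distX x x') x x' δ₀'
      (3 / 4 * δ₀') (δ₀' / 4) R R (by positivity) (by positivity) (by linarith) Rw.R_nonneg
      (G.dXU_nonneg j x) (G.dXU_nonneg j x') (G.dUU_nonneg j)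
      (fun y₁ y₂ => G.tri j x x' y₁ y₂ hj1 hj) (Rw.rowXU j x hj1 hj) (fun y => Rw.rowUU j y hj1 hj)
    have term : ∀ y₁ y₂, |D.K1 j μ x y₁ * D.K2 j y₁ y₂ * D.K3 j ν y₂ x'| ≤
        c₀ ^ 3 * (Real.exp (-(δ₀' * D.dXU j x y₁)) * Real.exp (-(δ₀' * D.dUU j y₁ y₂)) *
          Real.exp (-(δ₀' * D.dXU j x' y₂))) := by
      intro y₁ y₂
      rw [abs_mul, abs_mul]
      calc |D.K1 j μ x y₁| * |D.K2 j y₁ y₂| * |D.K3 j ν y₂ x'|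
          ≤ (c₀ * Real.exp (-(δ₀' * D.dXU j x y₁))) * (c₀ * Real.exp (-(δ₀' * D.dUU j y₁ y₂))) *
              (c₀ * Real.exp (-(δ₀' * D.dXU j x' y₂))) :=
            mul_le_mul (mul_le_mul (h1 μ x y₁) (h2 y₁ y₂) (abs_nonneg _) (by positivity)) (h3 ν y₂ x')
              (abs_nonneg _) (by positivity)
        _ = c₀ ^ 3 * (Real.exp (-(δ₀' * D.dXU j x y₁)) * Real.exp (-(δ₀' * D.dUU j y₁ y₂)) *
              Real.exp (-(δ₀' * D.dXU j x' y₂))) := by ring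
    calc |D.a j ^ 2 * ∑ y₁ ∈ D.TU j, ∑ y₂ ∈ D.TU j, D.K1 j μ x y₁ * D.K2 j y₁ y₂ * D.K3 j ν y₂ x'|
        = D.a j ^ 2 * |∑ y₁ ∈ D.TU j, ∑ y₂ ∈ D.TU j, D.K1 j μ x y₁ * D.K2 j y₁ y₂ * D.K3 j ν y₂ x'| := by
          rw [abs_mul, abs_of_nonneg (sq_nonneg _)]
      _ ≤ ā ^ 2 * ∑ y₁ ∈ D.TU j, ∑ y₂ ∈ D.TU j, |D.K1 j μ x y₁ * D.K2 j y₁ y₂ * D.K3 j ν y₂ x'| := by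
          refine mul_le_mul haj ?_ (abs_nonneg _) (by positivity)
          exact (Finset.abs_sum_le_sum_abs _ _).trans
            (Finset.sum_le_sum fun y₁ _ => Finset.abs_sum_le_sum_abs _ _)
      _ ≤ ā ^ 2 * ∑ y₁ ∈ D.TU j, ∑ y₂ ∈ D.TU j, c₀ ^ 3 * (Real.exp (-(δ₀' * D.dXU j x y₁)) *
            Real.exp (-(δ₀' * D.dUU j y₁ y₂)) * Real.exp (-(δ₀' * D.dXU j x' y₂))) :=
          mul_le_mul_of_nonneg_left
            (Finset.sum_le_sum fun y₁ _ => Finset.sum_le_sum fun y₂ _ => term y₁ y₂) (by positivity)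
      _ = ā ^ 2 * (c₀ ^ 3 * ∑ y₁ ∈ D.TU j, ∑ y₂ ∈ D.TU j, (Real.exp (-(δ₀' * D.dXU j x y₁)) *
            Real.exp (-(δ₀' * D.dUU j y₁ y₂)) * Real.exp (-(δ₀' * D.dXU j x' y₂)))) := by
          simp_rw [Finset.mul_sum]
      _ ≤ ā ^ 2 * (c₀ ^ 3 * (R * R * Real.exp (-(3 / 4 * δ₀' * (L ^ (S.k - j) * D.distX x x'))))) :=
          mul_le_mul_of_nonneg_left (mul_le_mul_of_nonneg_left conv (by positivity)) (by positivity)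
      _ = ā ^ 2 * c₀ ^ 3 * R ^ 2 * Real.exp (-(3 / 4 * δ₀' * (L ^ (S.k - j) * D.distX x x'))) := by ring
      _ ≤ (c₀ + ā ^ 2 * c₀ ^ 3 * R ^ 2) * Real.exp (-(3 / 4 * δ₀' * (L ^ (S.k - j) * D.distX x x'))) :=
          mul_le_mul_of_nonneg_right (le_add_of_nonneg_left hc₀) (Real.exp_nonneg _)


/-- **(1.137) kernel-checked from (1.136) and the estimates (2.35)/(2.37)** — the printed "applying the estimates
(2.35)–(2.37) of Lemma 2.4 in [2] we obtain for x ∈ Δ̃(y), supp f ⊂ Δ̃(y′) … (1.137), i.e., the inequality (1.112)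
with δ₀ = ½δ′₀", with every piece of its arithmetic explicit: the y, y′ convolution (`kerW_bound`), the support
bookkeeping (a non-zero summand has x′ ∈ Δ̃(y′) or x ∈ Δ̃(y′), so |y − y′| − c ≤ |x − x′| ≤ |(L^jη)^{−1}(x − x′)|
and e^{−(3/4)δ′₀D̃} ≤ e^{(1/2)δ′₀c}e^{−(1/2)δ′₀|y−y′|}e^{−(1/4)δ′₀D̃}, `exp_three_quarter_split`), the Hölder weight
(|f(x′) − f(x)| ≤ (‖f‖_ε + 2|f|)|x − x′|^ε, |x − x′|^ε = (L^jη)^ε|(L^jη)^{−1}(x − x′)|^ε, |·|^ε ≤ 1 + |·|), the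
x′ Riemann sum (≤ Λ) and the scale sum Σ_{j=0}^{k−1}(L^jη)^ε ≤ 1/(L^ε − 1) (`B5FromB4.scale_sum_bound`, the
printed "O(1) → ∞ if ε → 0").  Result: rate ½δ′₀ and O(1) = 2(c₀ + ā²c₀³R²)e^{(1/2)δ′₀c}Λ/(L^ε − 1). [cite: Balaban1984PropagatorsI, (1.136)–(1.137) pp.39–40] -/
theorem ineq137_of_display136 (D : ScaleData S) (L : ℝ) (d : ℕ) (c₀ δ₀' cc ā R Λ : ℝ) (hL : 1 < L)
    (hc₀ : 0 ≤ c₀) (hδ : 0 < δ₀') (ha : ∀ j, |D.a j| ≤ ā)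
    (h136 : Display136 D L d) (hleaf : Leaf235to237 D L c₀ δ₀') (G : Geometry D L cc)
    (Rw : RowSums D L d (δ₀' / 4) R Λ) (N : NormFacts D) :
    Ineq137 D (fun ε => 2 * ((c₀ + ā ^ 2 * c₀ ^ 3 * R ^ 2) * Real.exp (δ₀' / 2 * cc) * Λ) / (L ^ ε - 1))
      (δ₀' / 2) := by
  intro ε μ ν f x y y' hε0 hε1 hx hcube hsupp
  show |D.E μ ν f x| ≤ 2 * ((c₀ + ā ^ 2 * c₀ ^ 3 * R ^ 2) * Real.exp (δ₀' / 2 * cc) * Λ) / (L ^ ε - 1) *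
    Real.exp (-(δ₀' / 2 * S.dist y y')) * (D.holderF ε f + D.supF f)
  have hL0 : 0 < L := lt_trans zero_lt_one hL
  have hL1 : 1 ≤ L := hL.le
  have hH0 : 0 ≤ D.holderF ε f := N.holder_nonneg ε f
  have hM0 : 0 ≤ D.supF f := N.sup_nonneg f
  have hCW0 : 0 ≤ c₀ + ā ^ 2 * c₀ ^ 3 * R ^ 2 := by positivity
  have hΛ0 : 0 ≤ Λ := Rw.Λ_nonneg
  -- the constant in front of the (j, x′)-sums
  obtain ⟨A, hA⟩ : ∃ A : ℝ, A = (c₀ + ā ^ 2 * c₀ ^ 3 * R ^ 2) * Real.exp (δ₀' / 2 * cc) *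
      Real.exp (-(δ₀' / 2 * S.dist y y')) * (D.holderF ε f + 2 * D.supF f) := ⟨_, rfl⟩
  have hA0 : 0 ≤ A := by rw [hA]; positivity
  -- termwise bound of the (j, x′) summand of (1.136)
  have key : ∀ j ∈ Finset.range S.k, ∀ x' ∈ D.TX,
      |(L ^ (j * d))⁻¹ * kerW D j μ ν x x' * (D.eval f x' - D.eval f x)| ≤
        A * (L ^ ((j : ℝ) - S.k)) ^ ε * ((L ^ (j * d))⁻¹ *
          (Real.exp (-(δ₀' / 4 * (L ^ (S.k - j) * D.distX x x'))) * (1 + L ^ (S.k - j) * D.distX x x'))) := by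
    intro j hj x' _
    have hjk : j < S.k := Finset.mem_range.mp hj
    have hdX : 0 ≤ D.distX x x' := G.distX_nonneg x x'
    have hDt0 : 0 ≤ L ^ (S.k - j) * D.distX x x' := mul_nonneg (pow_nonneg hL0.le _) hdX
    have hLjd : 0 < (L ^ (j * d))⁻¹ := inv_pos.mpr (pow_pos hL0 _)
    have hsc : 0 ≤ (L ^ ((j : ℝ) - S.k)) ^ ε := Real.rpow_nonneg (Real.rpow_nonneg hL0.le _) _
    have hw0 : 0 ≤ (L ^ (j * d))⁻¹ * (Real.exp (-(δ₀' / 4 * (L ^ (S.k - j) * D.distX x x'))) *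
        (1 + L ^ (S.k - j) * D.distX x x')) :=
      mul_nonneg hLjd.le (mul_nonneg (Real.exp_nonneg _) (by linarith))
    by_cases hzero : D.eval f x' - D.eval f x = 0
    · rw [hzero, mul_zero, abs_zero]
      exact mul_nonneg (mul_nonneg hA0 hsc) hw0
    · -- support bookkeeping: a non-zero summand has x′ ∈ Δ̃(y′) or x ∈ Δ̃(y′)
      have hsep : S.dist y y' - cc ≤ D.distX x x' := by
        by_cases hfx' : D.eval f x' = 0
        · have hfx : D.eval f x ≠ 0 := by
            intro h0
            exact hzero (by rw [hfx', h0, sub_zero])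
          have hnear := G.cube_near x y y' hcube (hsupp x hfx)
          linarith
        · exact G.cube_sep x x' y y' hcube (hsupp x' hfx')
      have hsepD : S.dist y y' - cc ≤ L ^ (S.k - j) * D.distX x x' :=
        hsep.trans (dist_le_rescaled hL1 hdX _)
      have hW := kerW_bound D L c₀ δ₀' cc ā R Λ d hL1 hc₀ hδ.le ha hleaf G Rw hjk μ ν x x'
      have hsplit := exp_three_quarter_split hδ.le hsepD
      -- the Hölder weight: |x − x′|^ε = (L^{j−k})^ε · D̃^ε and |f(x′) − f(x)| ≤ (‖f‖_ε + 2|f|)|x − x′|^ε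
      have hdistε : D.distX x x' ^ ε = (L ^ ((j : ℝ) - S.k)) ^ ε * (L ^ (S.k - j) * D.distX x x') ^ ε := by
        rw [← Real.mul_rpow (Real.rpow_nonneg hL0.le _) hDt0, ← mul_assoc, scale_cancel hL0 hjk.le, one_mul]
      have hf : |D.eval f x' - D.eval f x| ≤ (D.holderF ε f + 2 * D.supF f) * D.distX x x' ^ ε :=
        holder_split hdX hH0 hM0 hε0 (fun h1 => N.holder_le ε f x x' hε0 h1) (N.sup_le f x') (N.sup_le f x)
      have hDtε : (L ^ (S.k - j) * D.distX x x') ^ ε ≤ 1 + L ^ (S.k - j) * D.distX x x' := by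
        -- D̃^ε ≤ 1 + D̃ for D̃ ≥ 0, 0 < ε < 1 (elementary; cf. `Percolation.rpow_le_one_add`, not imported here)
        rcases le_or_gt (L ^ (S.k - j) * D.distX x x') 1 with h1 | h1
        · exact (Real.rpow_le_one hDt0 h1 hε0.le).trans (by linarith)
        · calc (L ^ (S.k - j) * D.distX x x') ^ ε ≤ (L ^ (S.k - j) * D.distX x x') ^ (1 : ℝ) :=
                Real.rpow_le_rpow_of_exponent_le h1.le hε1.le
            _ = L ^ (S.k - j) * D.distX x x' := Real.rpow_one _
            _ ≤ 1 + L ^ (S.k - j) * D.distX x x' := by linarith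
      rw [abs_mul, abs_mul, abs_of_pos hLjd]
      calc (L ^ (j * d))⁻¹ * |kerW D j μ ν x x'| * |D.eval f x' - D.eval f x|
          ≤ (L ^ (j * d))⁻¹ * ((c₀ + ā ^ 2 * c₀ ^ 3 * R ^ 2) *
                Real.exp (-(3 / 4 * δ₀' * (L ^ (S.k - j) * D.distX x x')))) *
              ((D.holderF ε f + 2 * D.supF f) *
                ((L ^ ((j : ℝ) - S.k)) ^ ε * (L ^ (S.k - j) * D.distX x x') ^ ε)) := by
            rw [← hdistε]
            exact mul_le_mul (mul_le_mul_of_nonneg_left hW hLjd.le) hf (abs_nonneg _) (by positivity)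
        _ ≤ (L ^ (j * d))⁻¹ * ((c₀ + ā ^ 2 * c₀ ^ 3 * R ^ 2) *
                (Real.exp (δ₀' / 2 * cc) * Real.exp (-(δ₀' / 2 * S.dist y y')) *
                  Real.exp (-(δ₀' / 4 * (L ^ (S.k - j) * D.distX x x'))))) *
              ((D.holderF ε f + 2 * D.supF f) *
                ((L ^ ((j : ℝ) - S.k)) ^ ε * (1 + L ^ (S.k - j) * D.distX x x'))) := by
            apply mul_le_mul
            · exact mul_le_mul_of_nonneg_left (mul_le_mul_of_nonneg_left hsplit hCW0) hLjd.le
            · exact mul_le_mul_of_nonneg_left (mul_le_mul_of_nonneg_left hDtε hsc) (by positivity)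
            · positivity
            · positivity
        _ = A * (L ^ ((j : ℝ) - S.k)) ^ ε * ((L ^ (j * d))⁻¹ *
              (Real.exp (-(δ₀' / 4 * (L ^ (S.k - j) * D.distX x x'))) *
                (1 + L ^ (S.k - j) * D.distX x x'))) := by
            rw [hA]; ring
  -- summing: x′ (Riemann sum ≤ Λ), then j (scale sum ≤ 1/(L^ε − 1))
  have hLε : 0 < L ^ ε - 1 := by
    have := Real.one_lt_rpow hL hε0
    linarith
  have step1 : |D.E μ ν f x| ≤ ∑ j ∈ Finset.range S.k, A * (L ^ ((j : ℝ) - S.k)) ^ ε * Λ := by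
    rw [h136 μ ν f x hx]
    calc |∑ j ∈ Finset.range S.k, ∑ x' ∈ D.TX,
            (L ^ (j * d))⁻¹ * kerW D j μ ν x x' * (D.eval f x' - D.eval f x)|
        ≤ ∑ j ∈ Finset.range S.k, |∑ x' ∈ D.TX,
            (L ^ (j * d))⁻¹ * kerW D j μ ν x x' * (D.eval f x' - D.eval f x)| :=
          Finset.abs_sum_le_sum_abs _ _
      _ ≤ ∑ j ∈ Finset.range S.k, ∑ x' ∈ D.TX,
            |(L ^ (j * d))⁻¹ * kerW D j μ ν x x' * (D.eval f x' - D.eval f x)| :=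
          Finset.sum_le_sum fun j _ => Finset.abs_sum_le_sum_abs _ _
      _ ≤ ∑ j ∈ Finset.range S.k, ∑ x' ∈ D.TX, A * (L ^ ((j : ℝ) - S.k)) ^ ε * ((L ^ (j * d))⁻¹ *
            (Real.exp (-(δ₀' / 4 * (L ^ (S.k - j) * D.distX x x'))) * (1 + L ^ (S.k - j) * D.distX x x'))) :=
          Finset.sum_le_sum fun j hj => Finset.sum_le_sum fun x' hx' => key j hj x' hx'
      _ = ∑ j ∈ Finset.range S.k, A * (L ^ ((j : ℝ) - S.k)) ^ ε * ∑ x' ∈ D.TX, ((L ^ (j * d))⁻¹ *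
            (Real.exp (-(δ₀' / 4 * (L ^ (S.k - j) * D.distX x x'))) * (1 + L ^ (S.k - j) * D.distX x x'))) := by
          refine Finset.sum_congr rfl fun j _ => ?_
          rw [Finset.mul_sum]
      _ ≤ ∑ j ∈ Finset.range S.k, A * (L ^ ((j : ℝ) - S.k)) ^ ε * Λ :=
          Finset.sum_le_sum fun j hj => mul_le_mul_of_nonneg_left (Rw.lat j x (Finset.mem_range.mp hj) hx)
            (mul_nonneg hA0 (Real.rpow_nonneg (Real.rpow_nonneg hL0.le _) _))
  have step2 : ∑ j ∈ Finset.range S.k, A * (L ^ ((j : ℝ) - S.k)) ^ ε * Λ ≤ A * Λ * (1 / (L ^ ε - 1)) := by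
    have hre : ∑ j ∈ Finset.range S.k, A * (L ^ ((j : ℝ) - S.k)) ^ ε * Λ =
        A * Λ * ∑ j ∈ Finset.range S.k, (L ^ ((j : ℝ) - S.k)) ^ ε := by
      rw [Finset.mul_sum]
      exact Finset.sum_congr rfl fun j _ => by ring
    rw [hre]
    exact mul_le_mul_of_nonneg_left (B5FromB4.scale_sum_bound L ε hL hε0 S.k) (mul_nonneg hA0 hΛ0)
  -- (‖f‖_ε + 2|f|) ≤ 2(‖f‖_ε + |f|)
  obtain ⟨Q, hQ⟩ : ∃ Q : ℝ, Q = (c₀ + ā ^ 2 * c₀ ^ 3 * R ^ 2) * Real.exp (δ₀' / 2 * cc) * Λ / (L ^ ε - 1) *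
      Real.exp (-(δ₀' / 2 * S.dist y y')) := ⟨_, rfl⟩
  have hQ0 : 0 ≤ Q := by rw [hQ]; positivity
  have e1 : A * Λ * (1 / (L ^ ε - 1)) = Q * (D.holderF ε f + 2 * D.supF f) := by
    rw [hA, hQ]; ring
  have e2 : 2 * ((c₀ + ā ^ 2 * c₀ ^ 3 * R ^ 2) * Real.exp (δ₀' / 2 * cc) * Λ) / (L ^ ε - 1) *
      Real.exp (-(δ₀' / 2 * S.dist y y')) * (D.holderF ε f + D.supF f) =
        Q * (2 * (D.holderF ε f + D.supF f)) := by
    rw [hQ]; ring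
  calc |D.E μ ν f x| ≤ ∑ j ∈ Finset.range S.k, A * (L ^ ((j : ℝ) - S.k)) ^ ε * Λ := step1
    _ ≤ A * Λ * (1 / (L ^ ε - 1)) := step2
    _ = Q * (D.holderF ε f + 2 * D.supF f) := e1
    _ ≤ Q * (2 * (D.holderF ε f + D.supF f)) := mul_le_mul_of_nonneg_left (by linarith) hQ0
    _ = 2 * ((c₀ + ā ^ 2 * c₀ ^ 3 * R ^ 2) * Real.exp (δ₀' / 2 * cc) * Λ) / (L ^ ε - 1) *
          Real.exp (-(δ₀' / 2 * S.dist y y')) * (D.holderF ε f + D.supF f) := e2.symm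


/-! ## §5. (1.137) ⟹ the entry (1.112) for G′; Lemma 2.4 ⟹ the leaves; the hypothesis `h137` of
`B5FromB4.prop12G0_of_B4` discharged -/

/-- (1.137) for the d² scalar quantities (∂_μG′∂*_νJ_ν)(x) gives the entry (1.112) of Prop. 1.2 for G′ with the
constant multiplied by d (`Dict137`). [cite: Balaban1984PropagatorsI, (1.137)/(1.112) pp.36,40] -/
theorem e4Entry_of_ineq137 (D : ScaleData S) {d : ℕ} (Dc : Dict137 D d) (Sg : B5FromB4.ModelSigns S)
    {Cε : ℝ → ℝ} {δ : ℝ} (hC : ∀ ε, 0 < ε → ε < 1 → 0 ≤ Cε ε) (h : Ineq137 D Cε δ) :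
    B5FromB4.E4Entry S (fun ε => d * Cε ε) δ := by
  intro ε J y y' hε0 hε1 hs
  show S.e4 J y ≤ d * Cε ε * Real.exp (-(δ * S.dist y y')) * (S.holder ε J + S.supNorm J)
  have hC0 := hC ε hε0 hε1
  have hb0 : 0 ≤ Cε ε * Real.exp (-(δ * S.dist y y')) * (S.holder ε J + S.supNorm J) :=
    mul_nonneg (mul_nonneg hC0 (Real.exp_nonneg _)) (add_nonneg (Sg.holder_nonneg ε J) (Sg.supNorm_nonneg J))
  have hpt : ∀ (μ ν : D.Dir) (x : D.X), x ∈ D.TX → D.cube x y →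
      |D.E μ ν (D.comp J ν) x| ≤ Cε ε * Real.exp (-(δ * S.dist y y')) * (S.holder ε J + S.supNorm J) := by
    intro μ ν x hx hc
    refine (h ε μ ν (D.comp J ν) x y y' hε0 hε1 hx hc (Dc.supp J y' ν hs)).trans ?_
    exact mul_le_mul_of_nonneg_left (add_le_add (Dc.holder_le ε J ν) (Dc.sup_le J ν))
      (mul_nonneg hC0 (Real.exp_nonneg _))
  calc S.e4 J y ≤ d * (Cε ε * Real.exp (-(δ * S.dist y y')) * (S.holder ε J + S.supNorm J)) :=
      Dc.e4_le J y _ hb0 hpt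
    _ = d * Cε ε * Real.exp (-(δ * S.dist y y')) * (S.holder ε J + S.supNorm J) := by ring

/-- Merging the two second-order entry blocks of a family (each with its own rate) into `SecondOrderFam`:
δ₀ = min, constants max{·, 0} (the arithmetic of "with different constants O(1)", as in
`B5FromB4.prop12_of_blocks`). [folklore] -/
theorem secondOrderFam_of_entries {I : Type} (fam : I → B5.Setting) (Sg : ∀ i, B5FromB4.ModelSigns (fam i))
    {δ₁ δ₂ : ℝ} {Cε : ℝ → ℝ} {Cαε : ℝ → ℝ → ℝ} (hδ₁ : 0 < δ₁) (hδ₂ : 0 < δ₂)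
    (h4 : ∀ i, B5FromB4.E4Entry (fam i) Cε δ₁) (h2 : ∀ i, B5FromB4.H2Entry (fam i) Cαε δ₂) :
    B5FromB4.SecondOrderFam fam := by
  refine ⟨min δ₁ δ₂, fun ε => max (Cε ε) 0, fun α ε => max (Cαε α ε) 0, lt_min hδ₁ hδ₂, fun i => ⟨?_, ?_⟩⟩
  · intro ε J y y' hε0 hε1 hs
    exact B9FromB6.weaken3 (h4 i ε J y y' hε0 hε1 hs) (le_max_left _ _) (le_max_right _ _)
      (add_nonneg ((Sg i).holder_nonneg ε J) ((Sg i).supNorm_nonneg J)) (min_le_left _ _)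
      ((Sg i).dist_nonneg y y')
  · intro α ε J ζ y y' hα0 hε0 hαε hζ hs
    exact B5FromB4.weaken4 (h2 i α ε J ζ y y' hα0 hε0 hαε hζ hs) (le_max_left _ _) (le_max_right _ _)
      ((Sg i).cutH_nonneg α ζ) (add_nonneg ((Sg i).holder_nonneg _ J) ((Sg i).supNorm_nonneg J))
      (min_le_right _ _) ((Sg i).dist_nonneg y y')

/-- **Lemma 2.4 (2.35)/(2.37) ⟹ the leaf estimates on the kernels of (1.136)** through `Dict24`, with constant
4c₀e^{δ₀s₀} and the printed rate δ₀ (=: δ′₀ in B5's notation). [cite: Balaban1983RegularityDecay, Lemma 2.4 (2.35)/(2.37) p.582] -/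
theorem leaf_of_lemma24 {I₂₄ : Type} {fam₂₄ : I₂₄ → B4.ScaleSetting} {c₀ δ₀ : ℝ} (hc₀ : 0 < c₀)
    (hδ₀ : 0 < δ₀)
    (H24 : ∀ i : I₂₄, (fam₂₄ i).rectLarge →
      (∀ (x : (fam₂₄ i).SiteF) (y : (fam₂₄ i).SiteU),
          (fam₂₄ i).kerGQ x y ≤ c₀ * Real.exp (-(δ₀ * (fam₂₄ i).distF x y))) ∧
      (∀ (μ : (fam₂₄ i).Dir) (x : (fam₂₄ i).SiteF) (y : (fam₂₄ i).SiteU),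
          (fam₂₄ i).kerDGQ μ x y ≤ c₀ * Real.exp (-(δ₀ * (fam₂₄ i).distF x y))) ∧
      (∀ y y' : (fam₂₄ i).SiteU, (fam₂₄ i).kerC y y' ≤ c₀ * Real.exp (-(δ₀ * (fam₂₄ i).distU y y'))))
    (D : ScaleData S) (L s₀ : ℝ) (hs₀ : 0 ≤ s₀) (Dc : Dict24 fam₂₄ D L s₀) :
    Leaf235to237 D L (4 * c₀ * Real.exp (δ₀ * s₀)) δ₀ := by
  have hbig : c₀ ≤ 4 * c₀ * Real.exp (δ₀ * s₀) := by
    have h1 : 1 ≤ Real.exp (δ₀ * s₀) := Real.one_le_exp (by positivity)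
    nlinarith
  refine ⟨?_, fun j hj1 hjk => ?_⟩
  · obtain ⟨i, hrect, P, hcard, hK0, hdist⟩ := Dc.zero
    obtain ⟨-, -, hC⟩ := H24 i hrect
    intro μ ν x x'
    calc |D.K0 μ ν x x'| ≤ ∑ p ∈ P μ ν x x', (fam₂₄ i).kerC p.1 p.2 := hK0 μ ν x x'
      _ ≤ ∑ p ∈ P μ ν x x', c₀ * Real.exp (δ₀ * s₀) * Real.exp (-(δ₀ * (L ^ S.k * D.distX x x'))) := by
          refine Finset.sum_le_sum fun p hp => (hC p.1 p.2).trans ?_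
          rw [mul_assoc]
          exact mul_le_mul_of_nonneg_left (B5FromB4.exp_shift hδ₀.le (hdist μ ν x x' p hp)) hc₀.le
      _ = (P μ ν x x').card * (c₀ * Real.exp (δ₀ * s₀) * Real.exp (-(δ₀ * (L ^ S.k * D.distX x x')))) := by
          rw [Finset.sum_const, nsmul_eq_mul]
      _ ≤ 4 * (c₀ * Real.exp (δ₀ * s₀) * Real.exp (-(δ₀ * (L ^ S.k * D.distX x x')))) := by
          refine mul_le_mul_of_nonneg_right ?_ (by positivity)
          exact_mod_cast hcard μ ν x x'
      _ = 4 * c₀ * Real.exp (δ₀ * s₀) * Real.exp (-(δ₀ * (L ^ S.k * D.distX x x'))) := by ring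
  · obtain ⟨i, hrect, σ, τ, dir, hK1, hK3, hK2, hdF, hdU⟩ := Dc.mid j hj1 hjk
    obtain ⟨-, hDGQ, hC⟩ := H24 i hrect
    refine ⟨fun μ x y => ?_, fun y y' => ?_, fun ν y x' => ?_⟩
    · calc |D.K1 j μ x y| ≤ (fam₂₄ i).kerDGQ (dir μ) (σ x) (τ y) := hK1 μ x y
        _ ≤ c₀ * Real.exp (-(δ₀ * (fam₂₄ i).distF (σ x) (τ y))) := hDGQ (dir μ) (σ x) (τ y)
        _ ≤ 4 * c₀ * Real.exp (δ₀ * s₀) * Real.exp (-(δ₀ * D.dXU j x y)) := by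
            rw [hdF x y]; exact mul_le_mul_of_nonneg_right hbig (Real.exp_nonneg _)
    · calc |D.K2 j y y'| ≤ (fam₂₄ i).kerC (τ y) (τ y') := hK2 y y'
        _ ≤ c₀ * Real.exp (-(δ₀ * (fam₂₄ i).distU (τ y) (τ y'))) := hC (τ y) (τ y')
        _ ≤ 4 * c₀ * Real.exp (δ₀ * s₀) * Real.exp (-(δ₀ * D.dUU j y y')) := by
            rw [hdU y y']; exact mul_le_mul_of_nonneg_right hbig (Real.exp_nonneg _)
    · calc |D.K3 j ν y x'| ≤ (fam₂₄ i).kerDGQ (dir ν) (σ x') (τ y) := hK3 ν y x'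
        _ ≤ c₀ * Real.exp (-(δ₀ * (fam₂₄ i).distF (σ x') (τ y))) := hDGQ (dir ν) (σ x') (τ y)
        _ ≤ 4 * c₀ * Real.exp (δ₀ * s₀) * Real.exp (-(δ₀ * D.dXU j x' y)) := by
            rw [hdF x' y]; exact mul_le_mul_of_nonneg_right hbig (Real.exp_nonneg _)

/-- **The hypothesis `h137 : B4.Lemma24Printed fam₂₄ → SecondOrderFam famGp` of `B5FromB4.prop12G0_of_B4`
discharged, modulo located leaves.**  For the family of instances i = (k, T_η) of Prop. 1.2 for G′: the display
(1.136) (`h136`), the dictionaries `Dict24` (torus ↔ Lemma 2.4 instances — the "whole torus" leaf) and `Dict137`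
(scalar display ↔ entry (1.112)), the model-evident geometry / lattice sums / norm facts / signs, a uniform bound
|a_j| ≤ ā ("a_k is a constant proportional to a", [2] p. 573), and the printed sentence *"The proof of (1.113) is
similar"* (p. 40) as the named hypothesis `h113` (its derivation — from (1.135) and (2.36) — is NOT printed; cell
GAPS C-pv07-6) give: Lemma 2.4 of [2] ⟹ the second-order entries (1.112)–(1.113) for G′, with (1.112) at rate
½δ₀ KERNEL-CHECKED from (2.35)/(2.37) (`leaf_of_lemma24`, `ineq137_of_display136`, `e4Entry_of_ineq137`). [cite: Balaban1984PropagatorsI, (1.135)–(1.137) pp.39–40] -/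
theorem h137_of_display136 {I I₂₄ : Type} (fam₂₄ : I₂₄ → B4.ScaleSetting) (famGp : I → B5.Setting)
    (Dfam : ∀ i, ScaleData (famGp i)) (L : ℝ) (d : ℕ) (cc ā s₀ : ℝ) (hL : 1 < L) (hs₀ : 0 ≤ s₀)
    (ha : ∀ i j, |(Dfam i).a j| ≤ ā)
    (h136 : ∀ i, Display136 (Dfam i) L d) (D24 : ∀ i, Dict24 fam₂₄ (Dfam i) L s₀)
    (Dc : ∀ i, Dict137 (Dfam i) d) (G : ∀ i, Geometry (Dfam i) L cc)
    (hRow : ∀ κ : ℝ, 0 < κ → ∃ R Λ : ℝ, ∀ i, RowSums (Dfam i) L d κ R Λ)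
    (N : ∀ i, NormFacts (Dfam i)) (Sg : ∀ i, B5FromB4.ModelSigns (famGp i))
    (h113 : B4.Lemma24Printed fam₂₄ →
      ∃ δ₂ : ℝ, ∃ Cαε : ℝ → ℝ → ℝ, 0 < δ₂ ∧ ∀ i, B5FromB4.H2Entry (famGp i) Cαε δ₂) :
    B4.Lemma24Printed fam₂₄ → B5FromB4.SecondOrderFam famGp := by
  intro h24
  obtain ⟨δ₂, Cαε, hδ₂, H2⟩ := h113 h24
  obtain ⟨c₀, δ₀, hc₀, hδ₀, H24, -⟩ := h24
  obtain ⟨R, Λ, hRw⟩ := hRow (δ₀ / 4) (by positivity)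
  have hc₀' : 0 ≤ 4 * c₀ * Real.exp (δ₀ * s₀) := by positivity
  have hleaf : ∀ i, Leaf235to237 (Dfam i) L (4 * c₀ * Real.exp (δ₀ * s₀)) δ₀ := fun i =>
    leaf_of_lemma24 hc₀ hδ₀ H24 (Dfam i) L s₀ hs₀ (D24 i)
  have h137 : ∀ i, Ineq137 (Dfam i) (fun ε => 2 * ((4 * c₀ * Real.exp (δ₀ * s₀) +
      ā ^ 2 * (4 * c₀ * Real.exp (δ₀ * s₀)) ^ 3 * R ^ 2) * Real.exp (δ₀ / 2 * cc) * Λ) / (L ^ ε - 1))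
      (δ₀ / 2) := fun i =>
    ineq137_of_display136 (Dfam i) L d _ δ₀ cc ā R Λ hL hc₀' hδ₀ (ha i) (h136 i) (hleaf i) (G i) (hRw i) (N i)
  have hC : ∀ i : I, ∀ ε : ℝ, 0 < ε → ε < 1 → 0 ≤ 2 * ((4 * c₀ * Real.exp (δ₀ * s₀) +
      ā ^ 2 * (4 * c₀ * Real.exp (δ₀ * s₀)) ^ 3 * R ^ 2) * Real.exp (δ₀ / 2 * cc) * Λ) / (L ^ ε - 1) := by
    intro i ε hε0 _
    have hLε : 0 < L ^ ε - 1 := by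
      have := Real.one_lt_rpow hL hε0
      linarith
    have hΛ : 0 ≤ Λ := (hRw i).Λ_nonneg
    exact div_nonneg (by positivity) hLε.le
  have h4 : ∀ i, B5FromB4.E4Entry (famGp i) (fun ε => d * (2 * ((4 * c₀ * Real.exp (δ₀ * s₀) +
      ā ^ 2 * (4 * c₀ * Real.exp (δ₀ * s₀)) ^ 3 * R ^ 2) * Real.exp (δ₀ / 2 * cc) * Λ) / (L ^ ε - 1)))
      (δ₀ / 2) := fun i =>
    e4Entry_of_ineq137 (Dfam i) (Dc i) (Sg i) (hC i) (h137 i)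
  exact secondOrderFam_of_entries famGp Sg (half_pos hδ₀) hδ₂ h4 H2


/-- **`B5FromB4.prop12G0_of_B4` with `h137` discharged**: S3 of B5 Prop. 1.2 from [2] = B4 with the displayed
computation (1.135)–(1.137) kernel-checked — B4's Theorem (printed dependence) and Lemma 2.4 by name, the
dictionaries, the model-evident facts, and the passage's remaining sentences ("(1.113) is similar", "Prop. 1.1 for
G₀", "(1.114) … random walk", "(1.133) … weak bounds", the residual first-order entries) as the named hypotheses
they are in `B5FromB4`. [cite: Balaban1984PropagatorsI, pp.39–40] -/
theorem prop12G0_of_B4_via137 {I I₄ I₂₄ : Type} (fam₄ : I₄ → B4.EtaSetting) (fam₂₄ : I₂₄ → B4.ScaleSetting)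
    (famGp famG0 : I → B5.Setting) (F : ∀ i, B5FromB4.GpHolder (famGp i)) (c : ℝ) (ι : I → ℝ → I₄)
    (Dι : ∀ (i : I) (e : ℝ), 0 < e → B5FromB4.Dict (fam₄ (ι i e)) (famGp i) (F i) c e)
    (SgGp : ∀ i, B5FromB4.ModelSigns (famGp i)) (SgG0 : ∀ i, B5FromB4.ModelSigns (famG0 i))
    (hThm : B5FromB4.ThmDepPrinted fam₄) (h24 : B4.Lemma24Printed fam₂₄)
    (hRes : B5FromB4.ResidualGpFirst famGp F)
    (Dfam : ∀ i, ScaleData (famGp i)) (L : ℝ) (d : ℕ) (cc ā s₀ : ℝ) (hL : 1 < L) (hs₀ : 0 ≤ s₀)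
    (ha : ∀ i j, |(Dfam i).a j| ≤ ā)
    (h136 : ∀ i, Display136 (Dfam i) L d) (D24 : ∀ i, Dict24 fam₂₄ (Dfam i) L s₀)
    (Dc : ∀ i, Dict137 (Dfam i) d) (G : ∀ i, Geometry (Dfam i) L cc)
    (hRow : ∀ κ : ℝ, 0 < κ → ∃ R Λ : ℝ, ∀ i, RowSums (Dfam i) L d κ R Λ)
    (N : ∀ i, NormFacts (Dfam i))
    (h113 : B4.Lemma24Printed fam₂₄ →
      ∃ δ₂ : ℝ, ∃ Cαε : ℝ → ℝ → ℝ, 0 < δ₂ ∧ ∀ i, B5FromB4.H2Entry (famGp i) Cαε δ₂)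
    (h11G0 : B5.Prop11Printed famG0)
    (h114G0 : B5.Prop11Printed famG0 → B5.Local114Fam famG0)
    (transfer : B5FromB4.FirstOrderFam famGp → B5FromB4.SecondOrderFam famGp → B5.Local114Fam famG0 →
      B5FromB4.FirstOrderFam famG0 ∧ B5FromB4.SecondOrderFam famG0) :
    B5.Prop12Printed famG0 :=
  B5FromB4.prop12G0_of_B4 fam₄ fam₂₄ famGp famG0 F c ι Dι SgGp SgG0 hThm h24 hRes
    (h137_of_display136 fam₂₄ famGp Dfam L d cc ā s₀ hL hs₀ ha h136 D24 Dc G hRow N SgGp h113)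
    h11G0 h114G0 transfer

end Literature.MathematicalPhysics.QuantumFieldTheory.Balaban1983to89.B5Ineq137
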